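import Literature.Computability.AlgebraicComplexity.MatMul22mRankFiniteField
import Literature.Computability.AlgebraicComplexity.MatMulRankLowerBoundsBlaserProofs
import Mathlib.RingTheory.Localization.Away.Basic
import HarnessLib

/-!
# ω-census family (a): the Hopcroft–Kerr count `⌈7n/2⌉` is the EXACT rank of `⟨2,2,n⟩` over every commutative ring mapping to `𝔽₂` — `ℤ`, `ℤ[1/p]` (`p` odd), `ℤ/2^k`

Cell `pub-omega` (unit `pub-omega-tensor`, gen 37), topic `Summits/MatrixMultiplication/OmegaCensus` (sub-folder `SmallFormats`). Framing
(verbatim): lottery ticket; floor = certified bounds/negative ranges. HONEST FRAMING: bookkeeping by base change (Bläser 1999 §5 (10), tree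
`tensorRank_matMulTensor_map_le`) of the tree's `𝔽₂` theorem `tensorRank_matMulTensor_22n_card_two` (Hopcroft–Kerr 1971 / Alekseev–Nazarov 2019:
`R_𝔽₂(⟨2,2,n⟩) = ⌈7n/2⌉`) together with Hopcroft–Kerr's integral `⌈7n/2⌉`-product schemes (`hopcroftKerr1971_tensorRank_matMulTensor_22n_le`, every
commutative ring): for EVERY `n` and every commutative ring `K` with a homomorphism `K → 𝔽₂`, `R_K(⟨2,2,n⟩) = ⌈7n/2⌉`. For the census this is the
statement that integer / `ℤ[1/3]` / `ℤ[1/5]` searches can never beat Hopcroft–Kerr on `⟨2,2,n⟩`; only rings where `2` is invertible (e.g. `ℤ[1/2]`,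
`𝔽₃` — see `MatMul225RankOverRingsToF3`) can. Nothing here is a bound on `ω`.
-/

namespace Summit.MatrixMultiplication.OmegaCensus.SmallFormats

open Literature.Computability.AlgebraicComplexity

/-- **`R_K(⟨2,2,n⟩) = ⌈7n/2⌉` for every `n` and every commutative ring `K` with a ring homomorphism to `𝔽₂`.** -/
theorem tensorRank_matMulTensor_22n_of_ringHom_zmod2 {K : Type*} [CommRing K] (f : K →+* ZMod 2) (n : ℕ) :
    tensorRank (matMulTensor K 2 2 n) = (7 * n + 1) / 2 := by
  haveI : Fact (Nat.Prime 2) := ⟨Nat.prime_two⟩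
  have h1 := tensorRank_matMulTensor_map_le f 2 2 n
  have h2 := hopcroftKerr1971_tensorRank_matMulTensor_22n_le (K := K) n
  have h3 := tensorRank_matMulTensor_22n_card_two (ZMod 2) (ZMod.card 2) n
  omega

/-- **Over the integers**: `R_ℤ(⟨2,2,n⟩) = ⌈7n/2⌉` for every `n` (Hopcroft–Kerr's algorithms are optimal among integer bilinear algorithms). -/
theorem tensorRank_matMulTensor_22n_int (n : ℕ) : tensorRank (matMulTensor ℤ 2 2 n) = (7 * n + 1) / 2 :=
  tensorRank_matMulTensor_22n_of_ringHom_zmod2 (Int.castRingHom (ZMod 2)) n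

/-- **Over `ℤ/2^k`** (`k ≥ 1`): `R(⟨2,2,n⟩) = ⌈7n/2⌉`. -/
theorem tensorRank_matMulTensor_22n_zmod_two_pow (k n : ℕ) (hk : 1 ≤ k) :
    tensorRank (matMulTensor (ZMod (2 ^ k)) 2 2 n) = (7 * n + 1) / 2 :=
  tensorRank_matMulTensor_22n_of_ringHom_zmod2 (ZMod.castHom (dvd_pow_self 2 (by omega)) (ZMod 2)) n

/-- **Over `ℤ[1/p]` for an odd prime — indeed for any odd `p`**: `R_{ℤ[1/p]}(⟨2,2,n⟩) = ⌈7n/2⌉` (inverting an odd integer keeps the map to `𝔽₂`). -/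
theorem tensorRank_matMulTensor_22n_away_odd (p : ℤ) (hp : Odd p) (n : ℕ) :
    tensorRank (matMulTensor (Localization.Away p) 2 2 n) = (7 * n + 1) / 2 := by
  have hu : IsUnit ((Int.castRingHom (ZMod 2)) p) := by
    have h1 : ((p : ℤ) : ZMod 2) = 1 := by
      obtain ⟨k, rfl⟩ := hp
      push_cast
      rw [show (2 : ZMod 2) = 0 from by decide, zero_mul, zero_add]
    rw [eq_intCast, h1]
    exact isUnit_one
  exact tensorRank_matMulTensor_22n_of_ringHom_zmod2 (IsLocalization.Away.lift (S := Localization.Away p) p hu) n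

end Summit.MatrixMultiplication.OmegaCensus.SmallFormats
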